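import Summits.QuantumAdvantage.QuantumAdvantage.Theorems.NearExactIsExact.Negative.ConcatDefect
import Summits.QuantumAdvantage.QuantumAdvantage.Theorems.CubicForrelationNearExactIsExactRankTwoCeilingA

/-!
# Crux `CubicForrelation.NearExactIsExact` (stmt-QuantumAdvantage-14043) — negative side (disprove, gen 19):
  RANK-2 QUADRATIC TWISTS of an exact bent centre never enter the window `(15/16, 1)`

The "two-piece / fibre-twist" habitat of DISPROOF.md §26 (HOME `run/shared/lean/b2b/cubic-forrelation/`):
`c` bent on `m + m` bits with CUBIC dual `d` (an EXACT centre, e.g. Maiorana–McFarland over a biquadratic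
permutation), `t = c ⊕ ℓ_α ℓ_β` a rank-2 quadratic twist (`ℓ_α(x) = α·x`, `ℓ_β(x) = β·x`, read through
`signOf (la x) = twist x α`), and the 4-concatenation `G = c ‖ t ‖ t ‖ ¬c` of `…ConcatAveraging` /
`…Negative.ConcatDefect` (`G(y,a,b) = c(y) ⊕ (a ⊕ b)(ℓ_α ℓ_β)(y) ⊕ ab`, cubic).  The tree's 16-bit record
`15/16` (`FifteenSixteenths.lean`) is of exactly this shape (centre on 14 bits, rank-2 twist).
* `tr_W_twist` — the four-term Walsh identity
  `2·W_t(u) = W_c(u) + W_c(u ⊕ α) + W_c(u ⊕ β) − W_c(u ⊕ α ⊕ β)` [folklore];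
* `tr_W_twist_dual` — if the second derivative `D_α D_β d` vanishes identically then `t` is bent with dual
  `d ⊕ (D_α d)(D_β d)` (S. Mesnager, *Several new infinite families of bent functions and their duals*,
  IEEE Trans. Inform. Theory 60 (2014) 4397–4407, Thm. for `f ⊕ Tr(ux)Tr(vx)`; C. Tang, Z. Zhou, Y. Qi,
  X. Zhang, C. Fan, T. Helleseth, arXiv:1508.05673 §3 — the generic version), and CONVERSELY
  `tr_second_deriv_of_bent` — if `t` is bent (Walsh spectrum `± 2^m`, any sign pattern) then `D_α D_β d ≡ 0`:
  the criterion is an EQUIVALENCE, so the dual formula covers every bent rank-2 twist;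
* `tr_deg_residual` / `tr_sixteen_mul_card` — the dual difference `q = (D_α d)(D_β d)` has degree `≤ 4`
  (`stub_derivDegree`, `bb_deg_and`), hence is `0` mod `RM(2)` or at distance `≥ 2^{m+m-4}` from it
  (`stub_rmWeight`);
* `tr_concat_le_fifteen_sixteenths` / `tr_concat_exact_or_le` — THEOREM R2: for every such `G`, either the
  dual pattern is cubic and `G` has an exact cubic partner (`Φ = 1`), or `Φ(f, G) ≤ 15/16` for EVERY cubic
  `f` (`cd_forrelation_concat_le_mul` with `k = 16`).  So `31/32` (the first value above the standing
  records that a NearExactIsExact-violating sequence must pass) is out of reach of rank-2 twists at every `n`.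
Relation to `…RankTwoCeilingA/…RankTwoCeiling` (`ar_rankTwoCeiling`: the STAND-ALONE perturbed function
`g ⊕ ℓ₁ℓ₂ ⊕ ℓ₃` of an exact pair has `Φ = 1 ∨ Φ ≤ 31/32`): here the twisted function is used as the middle
pieces of a 4-concatenation around its own centre, the construction that realises the tree's records, and the
ceiling drops to `15/16` with the exact dual in hand.
HONEST FRAMING: a structural no-go for one amplification mechanism (value = theorem), NOT summit progress; it
neither proves nor refutes `NearExactIsExact`.  Standard axioms. [folklore]
-/

set_option linter.dupNamespace false -- D-0017: single-problem summit ⇒ `QuantumAdvantage.QuantumAdvantage` by design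

noncomputable section

namespace Summit.QuantumAdvantage.QuantumAdvantage.Theorems.NearExactIsExact.Negative.TwistRankTwo

open Finset
open Literature.Computability.QuantumComplexity
open Literature.Computability.QuantumComplexity.BuzetChailloux (bxor twist_bxor_right)
open Literature.Computability.QuantumComplexity.DerivativeWalsh (W)
open Summit.QuantumAdvantage.QuantumAdvantage.Theorems.CubicForrelation.NearExactIsExact
  (bb_deg_xor bb_deg_and stub_rmWeight stub_derivDegree ar_signOf_and)
open Summit.QuantumAdvantage.QuantumAdvantage.Theorems.NearExactIsExact.Negative.ConcatDefect
  (cd_forrelation_concat_le_mul cd_concat_exact_of_quadratic_diff)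

variable {n m : ℕ}

/-! ### The Walsh transform of a rank-2 twist -/

/-- A shifted Walsh coefficient: `W_f(u ⊕ v) = Σ_x f(x) (-1)^{x·v} (-1)^{x·u}`. [folklore] -/
theorem tr_W_bxor (f : (Fin n → Bool) → ℝ) (u v : Fin n → Bool) :
    W f (bxor u v) = ∑ x, f x * twist x v * twist x u := by
  unfold W
  refine sum_congr rfl fun x _ => ?_
  rw [twist_bxor_right]
  ring

/-- **Four-term identity.** For `t = c ⊕ ℓ_α ℓ_β` (`(-1)^{ℓ_α(x)} = (-1)^{x·α}`, `(-1)^{ℓ_β(x)} = (-1)^{x·β}`):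
`W_t(u) = (W_c(u) + W_c(u ⊕ α) + W_c(u ⊕ β) − W_c(u ⊕ α ⊕ β)) / 2`. [folklore] -/
theorem tr_W_twist (c la lb : (Fin n → Bool) → Bool) (α β : Fin n → Bool)
    (hla : ∀ x, signOf (la x) = twist x α) (hlb : ∀ x, signOf (lb x) = twist x β) (u : Fin n → Bool) :
    W (fun y => signOf (c y ^^ (la y && lb y))) u =
      (W (fun y => signOf (c y)) u + W (fun y => signOf (c y)) (bxor u α)
        + W (fun y => signOf (c y)) (bxor u β) - W (fun y => signOf (c y)) (bxor (bxor u α) β)) / 2 := by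
  rw [tr_W_bxor _ u α, tr_W_bxor _ u β, tr_W_bxor _ (bxor u α) β]
  have key : ∀ y : Fin n → Bool, signOf (c y ^^ (la y && lb y)) * twist y u =
      (signOf (c y) * twist y u + signOf (c y) * twist y α * twist y u
        + signOf (c y) * twist y β * twist y u
        - signOf (c y) * twist y β * twist y (bxor u α)) / 2 := by
    intro y
    rw [signOf_xor, ar_signOf_and, hla, hlb, twist_bxor_right y u α]
    ring
  unfold W
  simp_rw [key]
  rw [← sum_div, sum_sub_distrib, sum_add_distrib, sum_add_distrib]

/-- **Dual of a rank-2 twist** (Mesnager 2014; Tang–Zhou–Qi–Zhang–Fan–Helleseth, arXiv:1508.05673 §3).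
If `c` is bent with dual `d` (`W_c = K·(-1)^d`) and the second derivative `D_α D_β d` vanishes identically,
then `t = c ⊕ ℓ_α ℓ_β` is bent with dual `d ⊕ (D_α d)(D_β d)`. [folklore] -/
theorem tr_W_twist_dual (c d la lb : (Fin n → Bool) → Bool) (α β : Fin n → Bool) (K : ℝ)
    (hc : ∀ u, W (fun y => signOf (c y)) u = K * signOf (d u))
    (hla : ∀ x, signOf (la x) = twist x α) (hlb : ∀ x, signOf (lb x) = twist x β)
    (hαβ : ∀ u, (d u ^^ d (bxor u α) ^^ d (bxor u β) ^^ d (bxor (bxor u α) β)) = false)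
    (u : Fin n → Bool) :
    W (fun y => signOf (c y ^^ (la y && lb y))) u =
      K * signOf (d u ^^ ((d u ^^ d (bxor u α)) && (d u ^^ d (bxor u β)))) := by
  rw [tr_W_twist c la lb α β hla hlb u, hc, hc, hc, hc]
  have h4 : d (bxor (bxor u α) β) = (d u ^^ d (bxor u α) ^^ d (bxor u β)) := by
    have h := hαβ u
    revert h
    rcases Bool.eq_false_or_eq_true (d u) with h1 | h1 <;>
      rcases Bool.eq_false_or_eq_true (d (bxor u α)) with h2 | h2 <;>
        rcases Bool.eq_false_or_eq_true (d (bxor u β)) with h3 | h3 <;>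
          rcases Bool.eq_false_or_eq_true (d (bxor (bxor u α) β)) with h5 | h5 <;>
            simp [h1, h2, h3, h5]
  rw [h4]
  rcases Bool.eq_false_or_eq_true (d u) with h1 | h1 <;>
    rcases Bool.eq_false_or_eq_true (d (bxor u α)) with h2 | h2 <;>
      rcases Bool.eq_false_or_eq_true (d (bxor u β)) with h3 | h3 <;>
        simp [h1, h2, h3, signOf] <;> ring

/-- **Converse: bentness forces `D_α D_β d ≡ 0`.** If `t = c ⊕ ℓ_α ℓ_β` is bent (Walsh spectrum `K·(±1)`,
`K ≠ 0`, with ANY sign pattern `d'`), then `d(u) ⊕ d(u⊕α) ⊕ d(u⊕β) ⊕ d(u⊕α⊕β) = 0` for every `u`: by the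
four-term identity `2·(±1) = s₁ + s₂ + s₃ − s₄` with `sᵢ = ±1`, impossible when `s₁s₂s₃s₄ = −1`. [folklore] -/
theorem tr_second_deriv_of_bent (c d la lb d' : (Fin n → Bool) → Bool) (α β : Fin n → Bool) (K : ℝ)
    (hK : K ≠ 0) (hc : ∀ u, W (fun y => signOf (c y)) u = K * signOf (d u))
    (hla : ∀ x, signOf (la x) = twist x α) (hlb : ∀ x, signOf (lb x) = twist x β)
    (ht : ∀ u, W (fun y => signOf (c y ^^ (la y && lb y))) u = K * signOf (d' u)) (u : Fin n → Bool) :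
    (d u ^^ d (bxor u α) ^^ d (bxor u β) ^^ d (bxor (bxor u α) β)) = false := by
  have h := ht u
  rw [tr_W_twist c la lb α β hla hlb u, hc, hc, hc, hc] at h
  rcases Bool.eq_false_or_eq_true (d u) with h1 | h1 <;>
    rcases Bool.eq_false_or_eq_true (d (bxor u α)) with h2 | h2 <;>
      rcases Bool.eq_false_or_eq_true (d (bxor u β)) with h3 | h3 <;>
        rcases Bool.eq_false_or_eq_true (d (bxor (bxor u α) β)) with h5 | h5 <;>
          rcases Bool.eq_false_or_eq_true (d' u) with h6 | h6 <;>
            simp [h1, h2, h3, h5, h6, signOf] at h ⊢ <;>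
              (apply hK; linarith)

/-! ### The dual difference `q = (D_α d)(D_β d)`: degree `≤ 4`, hence far from `RM(2)` unless in it -/

/-- `q = (D_α d)(D_β d)` has degree `≤ 4` when `d` is cubic. -/
theorem tr_deg_residual (d : (Fin n → Bool) → Bool) (α β : Fin n → Bool) (hd : IsDegLeFun 3 d) :
    IsDegLeFun 4 (fun u => (d u ^^ d (bxor u α)) && (d u ^^ d (bxor u β))) :=
  bb_deg_and (stub_derivDegree n 2 d α hd) (stub_derivDegree n 2 d β hd) le_rfl

/-- A degree-`≤ 4` function that is not quadratic differs from every quadratic in at least `2^{N-4}` points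
(`16·#{q ≠ q₂} ≥ 2^N`; Reed–Muller minimum weight `stub_rmWeight`). -/
theorem tr_sixteen_mul_card {N : ℕ} (q : (Fin N → Bool) → Bool) (hq4 : IsDegLeFun 4 q)
    (hq : ¬ IsDegLeFun 2 q) (q₂ : (Fin N → Bool) → Bool) (hq₂ : IsDegLeFun 2 q₂) :
    2 ^ N ≤ 16 * (univ.filter fun u => q u ≠ q₂ u).card := by
  have hdeg : IsDegLeFun 4 (fun u => q u ^^ q₂ u) := bb_deg_xor hq4 (hq₂.mono (by norm_num))
  have hex : ∃ u, (q u ^^ q₂ u) = true := by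
    by_contra hnone
    push Not at hnone
    apply hq
    have e : q = q₂ := funext fun u => by
      have h := hnone u
      revert h
      cases q u <;> cases q₂ u <;> simp
    rw [e]
    exact hq₂
  have h := stub_rmWeight stub_derivDegree N 4 _ hdeg hex
  have e : (univ.filter fun u => (q u ^^ q₂ u) = true) = (univ.filter fun u => q u ≠ q₂ u) :=
    filter_congr fun u _ => by cases q u <;> cases q₂ u <;> simp
  rw [e] at h
  calc 2 ^ N ≤ 2 ^ 4 * (univ.filter fun u => q u ≠ q₂ u).card := h
    _ = 16 * (univ.filter fun u => q u ≠ q₂ u).card := by norm_num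

/-! ### THEOREM R2 -/

/-- **THEOREM R2 (window-free branch).** `c` bent on `m + m` bits with CUBIC dual `d`, `t = c ⊕ ℓ_α ℓ_β`
bent (equivalently `D_α D_β d ≡ 0`, `tr_second_deriv_of_bent`), and the dual difference `(D_α d)(D_β d)` NOT
quadratic: then EVERY cubic `f` has `Φ(f, c ‖ t ‖ t ‖ ¬c) ≤ 15/16`. -/
theorem tr_concat_le_fifteen_sixteenths (c d la lb : (Fin (m + m) → Bool) → Bool)
    (α β : Fin (m + m) → Bool)
    (hc : ∀ u, W (fun y => signOf (c y)) u = (2 : ℝ) ^ m * signOf (d u)) (hd : IsDegLeFun 3 d)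
    (hla : ∀ x, signOf (la x) = twist x α) (hlb : ∀ x, signOf (lb x) = twist x β)
    (hαβ : ∀ u, (d u ^^ d (bxor u α) ^^ d (bxor u β) ^^ d (bxor (bxor u α) β)) = false)
    (hq : ¬ IsDegLeFun 2 (fun u => (d u ^^ d (bxor u α)) && (d u ^^ d (bxor u β))))
    (f : (Fin (m + m + 2) → Bool) → Bool) (hf : IsDegLeFun 3 f) :
    forrelation f (fun y : Fin (m + m + 2) → Bool => xor (xor (c fun i => y (Fin.castAdd 2 i))
          ((xor (y (Fin.natAdd (m + m) 0)) (y (Fin.natAdd (m + m) 1))) &&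
            (xor (c fun i => y (Fin.castAdd 2 i))
              ((fun y => c y ^^ (la y && lb y)) fun i => y (Fin.castAdd 2 i)))))
          (y (Fin.natAdd (m + m) 0) && y (Fin.natAdd (m + m) 1))) ≤ 15 / 16 := by
  have h₂ : ∀ u, W (fun y => signOf ((fun y => c y ^^ (la y && lb y)) y)) u =
      (2 : ℝ) ^ m * signOf ((fun u => d u ^^ ((d u ^^ d (bxor u α)) && (d u ^^ d (bxor u β)))) u) :=
    tr_W_twist_dual c d la lb α β _ hc hla hlb hαβ
  have hT : ∀ q₂ : (Fin (m + m) → Bool) → Bool, IsDegLeFun 2 q₂ →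
      2 ^ (m + m) ≤ 16 * (univ.filter fun u =>
        (d u ^^ (fun u => d u ^^ ((d u ^^ d (bxor u α)) && (d u ^^ d (bxor u β)))) u) ≠ q₂ u).card := by
    intro q₂ hq₂
    have e : (univ.filter fun u =>
        (d u ^^ (fun u => d u ^^ ((d u ^^ d (bxor u α)) && (d u ^^ d (bxor u β)))) u) ≠ q₂ u) =
        (univ.filter fun u => ((d u ^^ d (bxor u α)) && (d u ^^ d (bxor u β))) ≠ q₂ u) :=
      filter_congr fun u _ => by
        have e1 : (d u ^^ (fun u => d u ^^ ((d u ^^ d (bxor u α)) && (d u ^^ d (bxor u β)))) u) =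
            ((d u ^^ d (bxor u α)) && (d u ^^ d (bxor u β))) := by
          show (d u ^^ (d u ^^ ((d u ^^ d (bxor u α)) && (d u ^^ d (bxor u β))))) = _
          rw [← Bool.xor_assoc, Bool.xor_self, Bool.false_xor]
        rw [e1]
    rw [e]
    exact tr_sixteen_mul_card _ (tr_deg_residual d α β hd) hq q₂ hq₂
  have h := cd_forrelation_concat_le_mul c (fun y => c y ^^ (la y && lb y)) d
    (fun u => d u ^^ ((d u ^^ d (bxor u α)) && (d u ^^ d (bxor u β)))) 16 (2 ^ (m + m)) (by norm_num)
    hc h₂ hT f hf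
  have e : ((2 ^ (m + m) : ℕ) : ℝ) / (((16 : ℕ) : ℝ) * 2 ^ (m + m)) = 1 / 16 := by
    rw [div_eq_div_iff (by positivity) (by norm_num)]
    push_cast
    ring
  rw [e] at h
  linarith

/-- **THEOREM R2 (dichotomy).** For `c` bent on `m + m` bits with cubic dual `d` and a bent rank-2 twist
`t = c ⊕ ℓ_α ℓ_β` (`D_α D_β d ≡ 0`): EITHER the dual pattern of `G = c ‖ t ‖ t ‖ ¬c` is cubic and is an exact
partner (`Φ = 1`), OR every cubic `f` has `Φ(f, G) ≤ 15/16`.  Rank-2 twists of exact centres never land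
in `(15/16, 1)`, at any number of bits. -/
theorem tr_concat_exact_or_le (c d la lb : (Fin (m + m) → Bool) → Bool) (α β : Fin (m + m) → Bool)
    (hc : ∀ u, W (fun y => signOf (c y)) u = (2 : ℝ) ^ m * signOf (d u)) (hd : IsDegLeFun 3 d)
    (hla : ∀ x, signOf (la x) = twist x α) (hlb : ∀ x, signOf (lb x) = twist x β)
    (hαβ : ∀ u, (d u ^^ d (bxor u α) ^^ d (bxor u β) ^^ d (bxor (bxor u α) β)) = false) :
    (∃ D : (Fin (m + m + 2) → Bool) → Bool, IsDegLeFun 3 D ∧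
      forrelation D (fun y : Fin (m + m + 2) → Bool => xor (xor (c fun i => y (Fin.castAdd 2 i))
          ((xor (y (Fin.natAdd (m + m) 0)) (y (Fin.natAdd (m + m) 1))) &&
            (xor (c fun i => y (Fin.castAdd 2 i))
              ((fun y => c y ^^ (la y && lb y)) fun i => y (Fin.castAdd 2 i)))))
          (y (Fin.natAdd (m + m) 0) && y (Fin.natAdd (m + m) 1))) = 1) ∨
    (∀ f : (Fin (m + m + 2) → Bool) → Bool, IsDegLeFun 3 f →
      forrelation f (fun y : Fin (m + m + 2) → Bool => xor (xor (c fun i => y (Fin.castAdd 2 i))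
          ((xor (y (Fin.natAdd (m + m) 0)) (y (Fin.natAdd (m + m) 1))) &&
            (xor (c fun i => y (Fin.castAdd 2 i))
              ((fun y => c y ^^ (la y && lb y)) fun i => y (Fin.castAdd 2 i)))))
          (y (Fin.natAdd (m + m) 0) && y (Fin.natAdd (m + m) 1))) ≤ 15 / 16) := by
  by_cases hq : IsDegLeFun 2 (fun u => (d u ^^ d (bxor u α)) && (d u ^^ d (bxor u β)))
  · left
    have h₂ : ∀ u, W (fun y => signOf ((fun y => c y ^^ (la y && lb y)) y)) u =
        (2 : ℝ) ^ m * signOf ((fun u => d u ^^ ((d u ^^ d (bxor u α)) && (d u ^^ d (bxor u β)))) u) :=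
      tr_W_twist_dual c d la lb α β _ hc hla hlb hαβ
    have hd₂ : IsDegLeFun 3 (fun u => d u ^^ ((d u ^^ d (bxor u α)) && (d u ^^ d (bxor u β)))) :=
      bb_deg_xor hd (hq.mono (by norm_num))
    have hqq : IsDegLeFun 2 (fun u =>
        d u ^^ (fun u => d u ^^ ((d u ^^ d (bxor u α)) && (d u ^^ d (bxor u β)))) u) := by
      have e : (fun u => d u ^^ (fun u => d u ^^ ((d u ^^ d (bxor u α)) && (d u ^^ d (bxor u β)))) u) =
          (fun u => (d u ^^ d (bxor u α)) && (d u ^^ d (bxor u β))) := funext fun u => by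
        show (d u ^^ (d u ^^ ((d u ^^ d (bxor u α)) && (d u ^^ d (bxor u β))))) = _
        rw [← Bool.xor_assoc, Bool.xor_self, Bool.false_xor]
      rw [e]
      exact hq
    obtain ⟨hD, hΦ⟩ := cd_concat_exact_of_quadratic_diff c (fun y => c y ^^ (la y && lb y)) d _ hc h₂ hd₂ hqq
    exact ⟨_, hD, hΦ⟩
  · right
    exact fun f hf => tr_concat_le_fifteen_sixteenths c d la lb α β hc hd hla hlb hαβ hq f hf

end Summit.QuantumAdvantage.QuantumAdvantage.Theorems.NearExactIsExact.Negative.TwistRankTwo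

end
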